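import Mathlib
import HarnessLib
import Summits.HubbardSuperconductivity.HubbardSuperconductivity.Theorems.KLProgrammeKLRegimeTwoVolumeGluedSourcePair

/-!
# Route `KLProgramme` — crux K3, VL child `KLRegimeVolumeLimitV17F2` (stmt-HubbardSuperconductivity-20440): `2ε·NEAR ≤ 2ε·GLUED_src + far rows` with the
# GLUED pinned defect restricted to SOURCE-PAIR strings (cell gate-hubbard-kl, seat hubbard-kl-k3c5-p3 g13, technique «OS-positivity-free direct assembly»)

The sharpening of `…TwoVolumeGluedSourcePair.twoEps_near_le_glued_add_far` (p581276) the END of 20440 actually uses: the NEAR same-offset defect of door (h)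
involves only strings whose BOTH legs are source legs (copy `1`), so in the GLUED pinned sum at the deep fine pin it suffices to sum over the strings `X` with
`X 0 =` the `(+)` source pin AND `(X 1).2 = 1`.  On such strings the kernels of the chain's doubled objects are the PLAIN position two-point kernels of
`𝒱_{n⋆}` whatever the alive family (`…TwoVolumeSourceReadout.kernel_klSrcAction_src`) and whatever uniform `ε`-weight the spine carries on its legs
(`…TwoVolumeGluedRescaling`: a constant factor) — so the END handshake becomes independent of k3c4-p1's located «(VL)-SUBDIAG-READOUT» (KL STATUS
2026-08-27 23:48Z: the spine's top object analyses its ALIVE legs with the family one level coarser than `klSrcAction`'s).  Same proof as p581276 §3, with the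
near embedding landing in the restricted filter.

* **`twoEps_near_le_gluedSrc_add_far`**.  Proof only; no definition.  References: BGM 2006 §2.4 (2.38), §2.9 (4.3)–(4.6).
-/

noncomputable section

namespace Summit.HubbardSuperconductivity.HubbardSuperconductivity.Theorems.TwoVolumeSource

set_option linter.dupNamespace false -- summit = problem name (single-conjunct summit), D-0017

open Finset Literature.MathematicalPhysics.QuantumLattice Literature.Probability.LatticeModels GrassmannAlgebra
open Summit.HubbardSuperconductivity.HubbardSuperconductivity.Theorems.KLProgrammeLegKernels
open Summit.HubbardSuperconductivity.HubbardSuperconductivity.Theorems.KLRegimeSplit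
open Summit.HubbardSuperconductivity.HubbardSuperconductivity.Theorems.TwoVolumeDefect
open Summit.HubbardSuperconductivity.HubbardSuperconductivity.Theorems.EngineV8

section NearGluedSrc

variable {b L Lf M : ℕ} [NeZero Lf] [NeZero L]

/-- **`2ε·NEAR ≤ 2ε·GLUED_src + 2(B_c + B_f)/(1 + Λ_n R)`** — as `twoEps_near_le_glued_add_far`, with the glued pinned sum restricted to the SOURCE-PAIR
strings `X 0 = (o_f, (s₀,↑,+), copy 1)`, `(X 1).2 = 1`. [cite: BenfattoGiulianiMastropietro2006, §2.4 (2.38)] -/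
theorem twoEps_near_le_gluedSrc_add_far (hLf : Lf = b * L) {β : ℝ} (hβ : 0 ≤ β) (U μ : ℝ) (Kc Kf : TrigPolyC4v) (n : ℕ)
    (of : SpaceTimeIdx Lf M) {R : ℕ} (hof : ∀ j, R ≤ (of.2 j).val % L ∧ (of.2 j).val % L + R < L) {Bc Bf : ℝ}
    (hBc : klSrcPinnedSum L M β U μ Kc n 2 2 0
      (((of.1, fun i => (((of.2 i).val : ℕ) : ZMod L)), ((⟨0, sectorCount_pos n⟩, 0), 0)), 1) ≤ Bc)
    (hBf : klSrcPinnedSum Lf M β U μ Kf n 2 2 0 ((of, ((⟨0, sectorCount_pos n⟩, 0), 0)), 1) ≤ Bf) :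
    2 * imagTimeWeight β M *
        (∑ t₁ : ImagTimeIdx M, ∑ ybar : TorusSite 2 L,
          ‖kernel ℂ (srcTrunc ℂ (fun Y : SrcLabel L M n => Y.2 = 1) 3 (klSrcAction L M β U μ Kc n)) 2
                ![(((of.1, fun i => (((of.2 i).val : ℕ) : ZMod L)), ((⟨0, sectorCount_pos n⟩, 0), 0)), 1),
                  (((t₁, (fun i => (((of.2 i).val : ℕ) : ZMod L)) + ybar), ((⟨0, sectorCount_pos n⟩, 0), 1)), 1)] -
              kernel ℂ (srcTrunc ℂ (fun Y : SrcLabel Lf M n => Y.2 = 1) 3 (klSrcAction Lf M β U μ Kf n)) 2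
                ![((of, ((⟨0, sectorCount_pos n⟩, 0), 0)), 1),
                  (((t₁, of.2 + Torus.proj Lf (Torus.cRep ybar)), ((⟨0, sectorCount_pos n⟩, 0), 1)), 1)]‖) ≤
      2 * imagTimeWeight β M *
          (∑ X ∈ univ.filter (fun X : Fin 2 → SrcLabel Lf M n => X 0 = ((of, ((⟨0, sectorCount_pos n⟩, 0), 0)), 1) ∧ (X 1).2 = 1),
            ‖kernel ℂ (srcTrunc ℂ (fun Y : SrcLabel Lf M n => Y.2 = 1) 3 (klSrcAction Lf M β U μ Kf n)) 2 X -
                (if ∀ i j, ((X i).1.1.2 j).val / L = ((X 0).1.1.2 j).val / L then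
                  kernel ℂ (srcTrunc ℂ (fun Y : SrcLabel L M n => Y.2 = 1) 3 (klSrcAction L M β U μ Kc n)) 2
                    (fun i => ((((X i).1.1.1, fun j => ((((X i).1.1.2 j).val : ℕ) : ZMod L)), (X i).1.2), (X i).2))
                else 0)‖) +
        2 * (Bc + Bf) / (1 + klScale klE0 n * R) := by
  -- names
  set sP : SectorLeg (sectorCount n) := ((⟨0, sectorCount_pos n⟩, 0), 0) with hsP
  set sM : SectorLeg (sectorCount n) := ((⟨0, sectorCount_pos n⟩, 0), 1) with hsM
  set Ac := srcTrunc ℂ (fun Y : SrcLabel L M n => Y.2 = 1) 3 (klSrcAction L M β U μ Kc n) with hAc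
  set Af := srcTrunc ℂ (fun Y : SrcLabel Lf M n => Y.2 = 1) 3 (klSrcAction Lf M β U μ Kf n) with hAf
  set ocs : TorusSite 2 L := fun i => (((of.2 i).val : ℕ) : ZMod L) with hocs
  set ε := imagTimeWeight β M with hε_def
  set Λ := klScale klE0 n with hΛ_def
  have hε : 0 ≤ ε := imagTimeWeight_nonneg hβ M
  have hΛ : 0 ≤ Λ := (klth_klScale_pos n).le
  -- the two source pairs and the glued summand
  let a : ImagTimeIdx M → TorusSite 2 L → ℂ := fun t₁ ybar =>
    kernel ℂ Ac 2 ![(((of.1, ocs), sP), 1), (((t₁, ocs + ybar), sM), 1)]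
  let f : ImagTimeIdx M → TorusSite 2 L → ℂ := fun t₁ ybar =>
    kernel ℂ Af 2 ![((of, sP), 1), (((t₁, of.2 + Torus.proj Lf (Torus.cRep ybar)), sM), 1)]
  let G : (Fin 2 → SrcLabel Lf M n) → ℝ := fun X =>
    ‖kernel ℂ Af 2 X - (if ∀ i j, ((X i).1.1.2 j).val / L = ((X 0).1.1.2 j).val / L then
        kernel ℂ Ac 2 (fun i => ((((X i).1.1.1, fun j => ((((X i).1.1.2 j).val : ℕ) : ZMod L)), (X i).1.2), (X i).2)) else 0)‖
  let Xf : ImagTimeIdx M → TorusSite 2 L → (Fin 2 → SrcLabel Lf M n) := fun t₁ ybar =>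
    ![((of, sP), 1), (((t₁, of.2 + Torus.proj Lf (Torus.cRep ybar)), sM), 1)]
  let Pn : TorusSite 2 L → Prop := fun ybar => ∀ i, (Torus.cRepZ (ybar i)).natAbs < R
  haveI hPnDec : DecidablePred Pn := fun ybar => by dsimp only [Pn]; infer_instance
  show 2 * ε * (∑ t₁, ∑ ybar, ‖a t₁ ybar - f t₁ ybar‖) ≤
    2 * ε * (∑ X ∈ univ.filter (fun X : Fin 2 → SrcLabel Lf M n => X 0 = ((of, sP), 1) ∧ (X 1).2 = 1), G X) + 2 * (Bc + Bf) / (1 + Λ * R)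
  -- (A) near offsets ARE glued strings at the pin
  have hnear : ∀ (t₁ : ImagTimeIdx M) (ybar : TorusSite 2 L), Pn ybar → ‖a t₁ ybar - f t₁ ybar‖ = G (Xf t₁ ybar) := by
    intro t₁ ybar hy
    have hblk : ∀ i j, (((Xf t₁ ybar) i).1.1.2 j).val / L = (((Xf t₁ ybar) 0).1.1.2 j).val / L := by
      intro i j
      fin_cases i
      · rfl
      · exact block_eq_of_deep_of_natAbs_lt hLf of.2 hof ybar hy j
    have hres : (fun i => (((((Xf t₁ ybar) i).1.1.1, fun j => (((((Xf t₁ ybar) i).1.1.2 j).val : ℕ) : ZMod L)), ((Xf t₁ ybar) i).1.2),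
        ((Xf t₁ ybar) i).2) : Fin 2 → SrcLabel L M n) = ![(((of.1, ocs), sP), 1), (((t₁, ocs + ybar), sM), 1)] := by
      funext i
      fin_cases i
      · rfl
      · show ((((t₁, fun j => ((((of.2 + Torus.proj Lf (Torus.cRep ybar)) j).val : ℕ) : ZMod L)), sM), 1) : SrcLabel L M n) =
          (((t₁, ocs + ybar), sM), 1)
        rw [reduce_add_clift hLf]
    show ‖a t₁ ybar - f t₁ ybar‖ = ‖kernel ℂ Af 2 (Xf t₁ ybar) - _‖
    rw [if_pos hblk, hres, norm_sub_rev]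
  -- (B) the near part ≤ the glued pinned defect
  have hG0 : ∀ X, 0 ≤ G X := fun X => norm_nonneg _
  have hXinj : Function.Injective (fun q : ImagTimeIdx M × TorusSite 2 L => Xf q.1 q.2) := by
    have hX1 : ∀ q : ImagTimeIdx M × TorusSite 2 L, ((Xf q.1 q.2) 1).1.1 = (q.1, of.2 + Torus.proj Lf (Torus.cRep q.2)) := fun q => rfl
    intro q q' h
    have h1 : ((Xf q.1 q.2) 1).1.1 = ((Xf q'.1 q'.2) 1).1.1 := congrArg (fun X : Fin 2 → SrcLabel Lf M n => (X 1).1.1) h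
    rw [hX1 q, hX1 q'] at h1
    obtain ⟨ht, hs⟩ := Prod.mk.inj h1
    exact Prod.ext ht (clift_injective hLf (add_left_cancel hs))
  have hB : ∑ t₁, ∑ ybar ∈ univ.filter Pn, ‖a t₁ ybar - f t₁ ybar‖ ≤
      ∑ X ∈ univ.filter (fun X : Fin 2 → SrcLabel Lf M n => X 0 = ((of, sP), 1) ∧ (X 1).2 = 1), G X := by
    haveI hdecX : DecidableEq (Fin 2 → SrcLabel Lf M n) := Classical.decEq _
    calc ∑ t₁, ∑ ybar ∈ univ.filter Pn, ‖a t₁ ybar - f t₁ ybar‖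
        = ∑ t₁, ∑ ybar ∈ univ.filter Pn, G (Xf t₁ ybar) :=
          sum_congr rfl fun t₁ _ => sum_congr rfl fun ybar hy => hnear t₁ ybar (mem_filter.1 hy).2
      _ ≤ ∑ t₁, ∑ ybar, G (Xf t₁ ybar) :=
          sum_le_sum fun t₁ _ => sum_le_sum_of_subset_of_nonneg (filter_subset _ _) fun ybar _ _ => hG0 _
      _ = ∑ q : ImagTimeIdx M × TorusSite 2 L, G (Xf q.1 q.2) :=
          (Fintype.sum_prod_type fun q : ImagTimeIdx M × TorusSite 2 L => G (Xf q.1 q.2)).symm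
      _ = ∑ X ∈ (univ : Finset (ImagTimeIdx M × TorusSite 2 L)).image (fun q => Xf q.1 q.2), G X :=
          (sum_image fun q _ q' _ h => hXinj h).symm
      _ ≤ ∑ X ∈ univ.filter (fun X : Fin 2 → SrcLabel Lf M n => X 0 = ((of, sP), 1) ∧ (X 1).2 = 1), G X := by
          refine sum_le_sum_of_subset_of_nonneg ?_ fun X _ _ => hG0 X
          intro X hX
          obtain ⟨q, -, rfl⟩ := mem_image.1 hX
          exact mem_filter.2 ⟨mem_univ _, rfl, rfl⟩
  -- (C) the far part ≤ far rows of both volumes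
  have hfar_y : ∀ ybar ∈ (univ : Finset (TorusSite 2 L)), ¬ Pn ybar → R ≤ Torus.tnorm ybar := fun ybar _ h => le_tnorm_of_not_near h
  have hfar_y' : ∀ ybar ∈ (univ : Finset (TorusSite 2 L)), ¬ Pn ybar → R ≤ Torus.tnorm (Torus.proj Lf (Torus.cRep ybar)) :=
    fun ybar _ h => (le_tnorm_of_not_near h).trans (tnorm_le_tnorm_clift hLf ybar)
  have hC1 : ∀ t₁ : ImagTimeIdx M, ∑ ybar ∈ univ.filter (fun y => ¬ Pn y), ‖a t₁ ybar‖ ≤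
      (1 + Λ * R)⁻¹ * ∑ ybar, (1 + Λ * (Torus.tnorm ybar : ℝ)) * ‖a t₁ ybar‖ := fun t₁ =>
    sum_filter_le_inv_mul_weighted univ Pn (fun y => ‖a t₁ y‖) (fun y => Torus.tnorm y) (fun _ _ => norm_nonneg _) hΛ hfar_y
  have hC2 : ∀ t₁ : ImagTimeIdx M, ∑ ybar ∈ univ.filter (fun y => ¬ Pn y), ‖f t₁ ybar‖ ≤
      (1 + Λ * R)⁻¹ * ∑ y' : TorusSite 2 Lf, (1 + Λ * (Torus.tnorm y' : ℝ)) * ‖kernel ℂ Af 2 ![((of, sP), 1), (((t₁, of.2 + y'), sM), 1)]‖ := by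
    intro t₁
    refine (sum_filter_le_inv_mul_weighted univ Pn (fun y => ‖f t₁ y‖) (fun y => Torus.tnorm (Torus.proj Lf (Torus.cRep y)))
      (fun _ _ => norm_nonneg _) hΛ hfar_y').trans ?_
    refine mul_le_mul_of_nonneg_left ?_ (by positivity)
    -- reindex by the injective centred lift and drop the other fine offsets
    let g : TorusSite 2 Lf → ℝ := fun y' => (1 + Λ * (Torus.tnorm y' : ℝ)) * ‖kernel ℂ Af 2 ![((of, sP), 1), (((t₁, of.2 + y'), sM), 1)]‖
    have hg0 : ∀ y', 0 ≤ g y' := fun y' => by positivity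
    calc ∑ y, (1 + Λ * (Torus.tnorm (Torus.proj Lf (Torus.cRep y)) : ℝ)) * ‖f t₁ y‖
        = ∑ y, g (Torus.proj Lf (Torus.cRep y)) := rfl
      _ = ∑ y' ∈ (univ : Finset (TorusSite 2 L)).image (fun y => Torus.proj Lf (Torus.cRep y)), g y' :=
          (sum_image fun y _ y' _ h => clift_injective hLf h).symm
      _ ≤ ∑ y', g y' := sum_le_sum_of_subset_of_nonneg (subset_univ _) fun y' _ _ => hg0 y'
  -- the weighted rows are token #24's two-source pinned sums
  have hWc : ε * ∑ t₁, ∑ ybar, (1 + Λ * (Torus.tnorm ybar : ℝ)) * ‖a t₁ ybar‖ ≤ Bc := by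
    have h := weightedRows_le_klSrcPinnedSum (L := L) (M := M) hβ U μ Kc n (of.1, ocs)
    refine le_trans (le_of_eq ?_) (h.trans hBc)
    simp only [hε_def, hΛ_def, a, hAc, hsP, hsM, kernel_srcTrunc_klSrcAction_pair]
  have hWf : ε * ∑ t₁, ∑ y' : TorusSite 2 Lf, (1 + Λ * (Torus.tnorm y' : ℝ)) * ‖kernel ℂ Af 2 ![((of, sP), 1), (((t₁, of.2 + y'), sM), 1)]‖ ≤ Bf := by
    have h := weightedRows_le_klSrcPinnedSum (L := Lf) (M := M) hβ U μ Kf n of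
    refine le_trans (le_of_eq ?_) (h.trans hBf)
    simp only [hε_def, hΛ_def, hAf, hsP, hsM, kernel_srcTrunc_klSrcAction_pair]
  -- assemble
  have hsplit : ∀ t₁ : ImagTimeIdx M, ∑ ybar, ‖a t₁ ybar - f t₁ ybar‖ =
      (∑ ybar ∈ univ.filter Pn, ‖a t₁ ybar - f t₁ ybar‖) + ∑ ybar ∈ univ.filter (fun y => ¬ Pn y), ‖a t₁ ybar - f t₁ ybar‖ :=
    fun t₁ => (sum_filter_add_sum_filter_not _ _ _).symm
  have hfar : ∀ t₁ : ImagTimeIdx M, ∑ ybar ∈ univ.filter (fun y => ¬ Pn y), ‖a t₁ ybar - f t₁ ybar‖ ≤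
      (1 + Λ * R)⁻¹ * ∑ ybar, (1 + Λ * (Torus.tnorm ybar : ℝ)) * ‖a t₁ ybar‖ +
        (1 + Λ * R)⁻¹ * ∑ y' : TorusSite 2 Lf, (1 + Λ * (Torus.tnorm y' : ℝ)) * ‖kernel ℂ Af 2 ![((of, sP), 1), (((t₁, of.2 + y'), sM), 1)]‖ := by
    intro t₁
    refine le_trans (sum_le_sum fun ybar _ => norm_sub_le (a t₁ ybar) (f t₁ ybar)) ?_
    rw [sum_add_distrib]
    exact add_le_add (hC1 t₁) (hC2 t₁)
  have hR1 : (0 : ℝ) < 1 + Λ * R := by positivity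
  calc 2 * ε * ∑ t₁, ∑ ybar, ‖a t₁ ybar - f t₁ ybar‖
      = 2 * ε * ∑ t₁, ((∑ ybar ∈ univ.filter Pn, ‖a t₁ ybar - f t₁ ybar‖) +
          ∑ ybar ∈ univ.filter (fun y => ¬ Pn y), ‖a t₁ ybar - f t₁ ybar‖) := by simp_rw [← hsplit]
    _ = 2 * ε * (∑ t₁, ∑ ybar ∈ univ.filter Pn, ‖a t₁ ybar - f t₁ ybar‖) +
          2 * ε * ∑ t₁, ∑ ybar ∈ univ.filter (fun y => ¬ Pn y), ‖a t₁ ybar - f t₁ ybar‖ := by rw [sum_add_distrib, mul_add]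
    _ ≤ 2 * ε * (∑ X ∈ univ.filter (fun X : Fin 2 → SrcLabel Lf M n => X 0 = ((of, sP), 1) ∧ (X 1).2 = 1), G X) +
          2 * ε * ∑ t₁, ((1 + Λ * R)⁻¹ * ∑ ybar, (1 + Λ * (Torus.tnorm ybar : ℝ)) * ‖a t₁ ybar‖ +
            (1 + Λ * R)⁻¹ * ∑ y' : TorusSite 2 Lf, (1 + Λ * (Torus.tnorm y' : ℝ)) *
              ‖kernel ℂ Af 2 ![((of, sP), 1), (((t₁, of.2 + y'), sM), 1)]‖) := by
        have h2ε : 0 ≤ 2 * ε := by positivity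
        exact add_le_add (mul_le_mul_of_nonneg_left hB h2ε) (mul_le_mul_of_nonneg_left (sum_le_sum fun t₁ _ => hfar t₁) h2ε)
    _ = 2 * ε * (∑ X ∈ univ.filter (fun X : Fin 2 → SrcLabel Lf M n => X 0 = ((of, sP), 1) ∧ (X 1).2 = 1), G X) +
          2 * (1 + Λ * R)⁻¹ * (ε * ∑ t₁, ∑ ybar, (1 + Λ * (Torus.tnorm ybar : ℝ)) * ‖a t₁ ybar‖ +
            ε * ∑ t₁, ∑ y' : TorusSite 2 Lf, (1 + Λ * (Torus.tnorm y' : ℝ)) *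
              ‖kernel ℂ Af 2 ![((of, sP), 1), (((t₁, of.2 + y'), sM), 1)]‖) := by
        rw [sum_add_distrib, ← mul_sum, ← mul_sum]; ring
    _ ≤ 2 * ε * (∑ X ∈ univ.filter (fun X : Fin 2 → SrcLabel Lf M n => X 0 = ((of, sP), 1) ∧ (X 1).2 = 1), G X) +
          2 * (1 + Λ * R)⁻¹ * (Bc + Bf) := by
        have h2R : 0 ≤ 2 * (1 + Λ * R)⁻¹ := by positivity
        exact add_le_add le_rfl (mul_le_mul_of_nonneg_left (add_le_add hWc hWf) h2R)
    _ = _ := by rw [div_eq_mul_inv]; ring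

end NearGluedSrc

end Summit.HubbardSuperconductivity.HubbardSuperconductivity.Theorems.TwoVolumeSource

end
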